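import Summits.BirchSwinnertonDyer.BirchSwinnertonDyer.Theorems.RamifiedHeegnerPairLeafRankZeroUpperAtThreeTowerRows
import Summits.BirchSwinnertonDyer.BirchSwinnertonDyer.Theorems.RamifiedHeegnerPairGss2LowerAtThreeRankOneNonTowerOfNonSurjThree
import HarnessLib

/-!
# Route `RamifiedHeegnerPair`, residual member U₀ `LeafRankZeroUpperAtThree` (stmt-BirchSwinnertonDyer-26024) BY NAME ⟸ Kato A161″ ∧ GZK ∧
# modularity ∧ U₀ on the `3Nn` rows ONLY — the fifth stub `stub_leafRankZeroUpper_nonsplitRows` of the L₁ skeleton v5 (26021) IS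
# the research content of 26024

HONEST FRAMING. Theorems only; helper file (`--supports stmt-BirchSwinnertonDyer-26024`); nothing is booked, no item is closed, BSD is not
proved for any curve. Lead prover bsd-line-rhp-p1 g6 (L₁ lead), 2026-08-28. One line over two landed files: rhp-p1 g3's
`RamifiedPairUpperBound.leafRankZeroUpperAtThree_of_katoTam_of_nonTower` (26024 ⟸ A161″ ∧ GZK ∧ modularity ∧ [U₀ on the NON-tower rows]) and
rhp-p1 g5's `RamifiedPairLowerBound.towerSurj_three_of_subGss_of_surj` (on the (G) cell at `3` the full 3-adic tower is AUTOMATIC from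
`ρ̄_{E,3}` onto: the exotic signature of `X4ExoticThree` lies in `SubW ⊥ SubGord`). Hence the non-tower rows of the Gss2 leaf are EXACTLY the
`3Nn` rows (`ρ̄_{E,3}` not onto; image `C_ns⁺(3)`, 53 rank-`0` classes of the census `N < 5·10⁵`), and

* `leafRankZeroUpperAtThree_of_katoTam_of_nonSurjThree` — 26024 BY NAME ⟸ A161″ (`Kato2004.rankZero_padicValNat_sha_add_padicValNat_tamagawa_le_…`,
  the last conjunct of PUB 27199) ∧ GZK ∧ modularity ∧ `hN3` = the text of the L₁ skeleton v5 stub `stub_leafRankZeroUpper_nonsplitRows`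
  VERBATIM (U₀ on the non-CM `3Nn` rank-`0` rows).

So the registered stub list of 26021's line (v5: PUB 27199 · A 27200 · STRUCT · A₃ₙₙ · U₀|3Nn) and the member U₀ 26024 share ONE research
statement on the `3Nn` rows, inside `EulerSystemBigImageBarrier` (Kato (12.5.2) fails for image `N_ns⁺(3)`). Memo COUPLING-CALCULUS-rhp-p1-g6.md.
References: [cite: Kato2004Asterisque, Thm. 14.5 (3) (p. 236), Prop. 14.16 (2) (p. 244), (12.5.2) (p. 222)] [cite: GreenbergLNM1716, Prop. 4.13]
[cite: Wuthrich2014, Lemma 20 (p. 399)] [cite: Miller2011LMS, Def. 1.1].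
-/

-- D-0017: single-problem summit, so `Summit.BirchSwinnertonDyer.BirchSwinnertonDyer.…` repeats a namespace BY DESIGN.
set_option linter.dupNamespace false
set_option autoImplicit false

noncomputable section

open scoped Classical NumberField

open WeierstrassCurve Literature.NumberTheory.EllipticCurves
  Literature.NumberTheory.EllipticCurves.Rank1Residual
  Literature.NumberTheory.EllipticCurves.Rank1Residual.Typed
  Summit.BirchSwinnertonDyer.Rank1Residual
  Summit.BirchSwinnertonDyer.Rank1Residual.Additive
  Summit.BirchSwinnertonDyer.BirchSwinnertonDyer.Theorems

namespace Summit.BirchSwinnertonDyer.BirchSwinnertonDyer.Theorems.RamifiedPairUpperBound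

/-- **26024 `LeafRankZeroUpperAtThree` BY NAME ⟸ A161″ ∧ GZK ∧ modularity ∧ [U₀ on the `3Nn` rank-zero rows].** `hN3` is the text of the L₁
skeleton v5 stub `stub_leafRankZeroUpper_nonsplitRows` verbatim. The tower rows are Kato-print (`leafRankZeroUpper_three_towerRows_of_katoTam`);
a row with `ρ̄_{E,3}` onto IS a tower row on the (G) cell (`RamifiedPairLowerBound.towerSurj_three_of_subGss_of_surj`). Closes nothing.
[cite: Kato2004Asterisque, Thm. 14.5 (3) (p. 236), Prop. 14.16 (2) (p. 244)] [cite: Wuthrich2014, Lemma 20 (p. 399)] [cite: Miller2011LMS, Def. 1.1] -/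
theorem leafRankZeroUpperAtThree_of_katoTam_of_nonSurjThree
    (hKatoT : Kato2004.rankZero_padicValNat_sha_add_padicValNat_tamagawa_le_of_additive_potGood_of_imageContainsSL2)
    (hGZK : rank_eq_analyticRank_of_analyticRank_le_one) (hmod : hasEntireLFunction_rat)
    (hN3 : ∀ (W : WeierstrassCurve ℚ) [W.IsElliptic] [W.IsGloballyMinimal], ¬ W.HasCM →
      Literature.NumberTheory.EllipticCurves.Rank1Residual.Addv W 3 → Summit.BirchSwinnertonDyer.Rank1Residual.Additive.SubGss W 3 →
      W.analyticRank = 0 → ¬ W.HasSurjectiveModNGaloisRep 3 →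
      Literature.NumberTheory.EllipticCurves.Rank1Residual.Typed.MissingUpperBoundAt W 3) :
    Summit.BirchSwinnertonDyer.BirchSwinnertonDyer.Theses.RamifiedHeegnerPair.LeafRankZeroUpperAtThree := by
  refine leafRankZeroUpperAtThree_of_katoTam_of_nonTower hKatoT hGZK hmod ?_
  intro W _ _ hCM hadd hsub hr hρ
  haveI : Fact (Nat.Prime 3) := ⟨Nat.prime_three⟩
  exact hN3 W hCM hadd hsub hr fun hs ↦ hρ (RamifiedPairLowerBound.towerSurj_three_of_subGss_of_surj W hadd hsub hs)

/-- **Conversely (bookkeeping): 26024 ⟹ the v5 stub** — U₀ on all rank-zero leaf rows trivially gives U₀ on the `3Nn` ones. So, GIVEN the three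
print facts, item 26024 and the stub `stub_leafRankZeroUpper_nonsplitRows` are EQUIVALENT. [cite: Miller2011LMS, Def. 1.1] -/
theorem nonSurjThreeRows_of_leafRankZeroUpperAtThree
    (hU0 : Summit.BirchSwinnertonDyer.BirchSwinnertonDyer.Theses.RamifiedHeegnerPair.LeafRankZeroUpperAtThree) :
    ∀ (W : WeierstrassCurve ℚ) [W.IsElliptic] [W.IsGloballyMinimal], ¬ W.HasCM →
      Literature.NumberTheory.EllipticCurves.Rank1Residual.Addv W 3 → Summit.BirchSwinnertonDyer.Rank1Residual.Additive.SubGss W 3 →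
      W.analyticRank = 0 → ¬ W.HasSurjectiveModNGaloisRep 3 →
      Literature.NumberTheory.EllipticCurves.Rank1Residual.Typed.MissingUpperBoundAt W 3 :=
  fun W _ _ hCM hadd hsub hr _ ↦ hU0 W hCM hadd hsub hr

end Summit.BirchSwinnertonDyer.BirchSwinnertonDyer.Theorems.RamifiedPairUpperBound

end
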